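import Summits.Ventures.WeilGRH.UniformConductorFloorLorentzBudget
import Summits.Ventures.WeilGRH.UniformConductorFloorCellsOneB
import Summits.Ventures.WeilGRH.UniformConductorFloorCellsFrontier
import Summits.Ventures.WeilGRH.UniformConductorFloorCellsLogTwoB
import HarnessLib

/-!
# GRH arm (rh-explicit, venture WeilGRH): uniform conductor floors — cell certificate + Lorentzian gain

Cell `rh-explicit`, WEIL TRACK — GRH ARM (weil-grh-1).  Instances of
`UniformFloor.weilPositivityOnChar_of_phi_budget_lorentz` (`UniformConductorFloorLorentzBudget.lean`): the cell
certificates of `UniformConductorFloorCells{OneB,Frontier,LogTwoB}.lean` for the primes (`ρ = 2.1506, 1.2555, 0.901`)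
together with the archimedean gain `γ = e^{−2xt}/x` (`x = ¼` even, `¾` odd) of the position-space Lorentzian:

| window `t` | `ρ` | `γ` even / odd | budget even / odd | **floor even (= all)** | **floor odd** |
|---|---|---|---|---|---|
| `1` | `2.1506` | `4e^{−1/2} ≥ 2.426` / `(4/3)e^{−3/2} ≥ 0.2975` | `5.0968` / `4.0837` | **`q ≥ 168`** (`164`) | **`q ≥ 60`** (`60`) |
| `4023/5000` | `1.2555` | `4e^{−0.4023} ≥ 2.675` / `(4/3)e^{−1.2069} ≥ 0.3987` | `3.9527` / `3.0874` | **`q ≥ 54`** (`53`) | **`q ≥ 24`** (`22`) |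
| `log 2` | `0.901` | `2√2 ≥ 2.8284` / `(4/3)2^{−3/2} ≥ 0.4714` | `3.4448` / `2.6602` | **`q ≥ 32`** (`32`) | **`q ≥ 15`** (`15`) |

(in brackets the method's floor `⌈e^{budget}⌉`; the cell-only floors were `256/80`, `70/35`, `40/24`; the sharp data floors are
`78/30`, `30/14`, `18/9`).  All statements are unconditional, uniform in the values of `χ`, with no `ζ` input and no kernel
certificate.

## References

* A. Weil (1952), (11) and the «lemme» p. 262 [Weil1952FormulesExplicites]; H. Yoshida (1992) §2, §6 [Yoshida1992].
-/

noncomputable section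

open Complex Filter Set MeasureTheory
open scoped Real Topology ComplexConjugate ArithmeticFunction.vonMangoldt

namespace Summit.Ventures.WeilGRH

open Literature.NumberTheory.LFunctions

namespace UniformFloor

variable {q : ℕ}

/-! ## The gains `γ ≤ e^{−2xt}/x` -/

/-- `e^{−1/2} ≥ 0.6065304` (eight terms of the exponential series). [folklore] -/
theorem exp_neg_half_ge : (0.6065304 : ℝ) ≤ Real.exp (-(1 / 2)) := by
  have h := Real.exp_bound (x := -(1 / 2)) (by rw [abs_neg, abs_of_nonneg (by norm_num)]; norm_num) (n := 8)
    (by norm_num)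
  have hs : (∑ m ∈ Finset.range 8, (-(1 / 2) : ℝ) ^ m / m.factorial) =
      1 - 1 / 2 + 1 / 8 - 1 / 48 + 1 / 384 - 1 / 3840 + 1 / 46080 - 1 / 645120 := by
    simp [Finset.sum_range_succ, Nat.factorial]
    norm_num
  rw [hs, abs_neg, abs_of_nonneg (by norm_num : (0 : ℝ) ≤ 1 / 2)] at h
  have h' := (abs_le.1 h).1
  norm_num [Nat.factorial] at h'
  linarith

/-- `γ` at `t = 1`, even: `2.426 ≤ e^{−2·¼·1}/¼ = 4e^{−1/2}`. [folklore] -/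
theorem gamma_one_even : (2.426 : ℝ) ≤ Real.exp (-(2 * (1 / 4 + ((0 : ℕ) : ℝ) / 2) * 1)) / (1 / 4 + ((0 : ℕ) : ℝ) / 2) := by
  have h := exp_neg_half_ge
  norm_num at h ⊢
  rw [le_div_iff₀ (by norm_num : (0 : ℝ) < 1 / 4)]
  linarith

/-- `γ` at `t = 1`, odd: `0.2975 ≤ e^{−2·¾·1}/¾ = (4/3)e^{−3/2}` (`e^{−3/2} = e^{−1}e^{−1/2}`). [folklore] -/
theorem gamma_one_odd : (0.2975 : ℝ) ≤ Real.exp (-(2 * (1 / 4 + ((1 : ℕ) : ℝ) / 2) * 1)) / (1 / 4 + ((1 : ℕ) : ℝ) / 2) := by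
  have h1 := exp_neg_half_ge
  have h2 := Real.exp_neg_one_gt_d9
  have e : Real.exp (-(2 * (1 / 4 + ((1 : ℕ) : ℝ) / 2) * 1)) = Real.exp (-1) * Real.exp (-(1 / 2)) := by
    rw [← Real.exp_add]; norm_num
  rw [e]
  have h0 : 0 ≤ Real.exp (-1) := (Real.exp_pos _).le
  norm_num
  nlinarith

/-- `e^{−0.4023} ≥ 0.66876` (six terms). [folklore] -/
theorem exp_neg_frontier_even_ge : (0.66876 : ℝ) ≤ Real.exp (-(4023 / 10000)) := by
  have h := Real.exp_bound (x := -(4023 / 10000)) (by rw [abs_neg, abs_of_nonneg (by norm_num)]; norm_num) (n := 6)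
    (by norm_num)
  have hs : (∑ m ∈ Finset.range 6, (-(4023 / 10000) : ℝ) ^ m / m.factorial) =
      1 - 4023 / 10000 + (4023 / 10000) ^ 2 / 2 - (4023 / 10000) ^ 3 / 6 + (4023 / 10000) ^ 4 / 24 -
        (4023 / 10000) ^ 5 / 120 := by
    simp [Finset.sum_range_succ, Nat.factorial]
    norm_num
  rw [hs, abs_neg, abs_of_nonneg (by norm_num : (0 : ℝ) ≤ 4023 / 10000)] at h
  have h' := (abs_le.1 h).1
  norm_num [Nat.factorial] at h'
  linarith

/-- `e^{−0.2069} ≥ 0.81302` (five terms). [folklore] -/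
theorem exp_neg_frontier_odd_ge : (0.81302 : ℝ) ≤ Real.exp (-(2069 / 10000)) := by
  have h := Real.exp_bound (x := -(2069 / 10000)) (by rw [abs_neg, abs_of_nonneg (by norm_num)]; norm_num) (n := 5)
    (by norm_num)
  have hs : (∑ m ∈ Finset.range 5, (-(2069 / 10000) : ℝ) ^ m / m.factorial) =
      1 - 2069 / 10000 + (2069 / 10000) ^ 2 / 2 - (2069 / 10000) ^ 3 / 6 + (2069 / 10000) ^ 4 / 24 := by
    simp [Finset.sum_range_succ, Nat.factorial]
    norm_num
  rw [hs, abs_neg, abs_of_nonneg (by norm_num : (0 : ℝ) ≤ 2069 / 10000)] at h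
  have h' := (abs_le.1 h).1
  norm_num [Nat.factorial] at h'
  linarith

/-- `γ` at `t = 4023/5000`, even: `2.675 ≤ 4e^{−0.4023}`. [folklore] -/
theorem gamma_frontier_even :
    (2.675 : ℝ) ≤ Real.exp (-(2 * (1 / 4 + ((0 : ℕ) : ℝ) / 2) * (4023 / 5000))) / (1 / 4 + ((0 : ℕ) : ℝ) / 2) := by
  have h := exp_neg_frontier_even_ge
  have e : Real.exp (-(2 * (1 / 4 + ((0 : ℕ) : ℝ) / 2) * (4023 / 5000))) = Real.exp (-(4023 / 10000)) := by
    norm_num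
  rw [e]
  norm_num
  linarith

/-- `γ` at `t = 4023/5000`, odd: `0.3987 ≤ (4/3)e^{−1.2069}` (`= (4/3)e^{−1}e^{−0.2069}`). [folklore] -/
theorem gamma_frontier_odd :
    (0.3987 : ℝ) ≤ Real.exp (-(2 * (1 / 4 + ((1 : ℕ) : ℝ) / 2) * (4023 / 5000))) / (1 / 4 + ((1 : ℕ) : ℝ) / 2) := by
  have h1 := exp_neg_frontier_odd_ge
  have h2 := Real.exp_neg_one_gt_d9
  have e : Real.exp (-(2 * (1 / 4 + ((1 : ℕ) : ℝ) / 2) * (4023 / 5000))) =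
      Real.exp (-1) * Real.exp (-(2069 / 10000)) := by
    rw [← Real.exp_add]; norm_num
  rw [e]
  have h0 : 0 ≤ Real.exp (-1) := (Real.exp_pos _).le
  norm_num
  nlinarith

/-- `γ` at `t = log 2`, even: `2.8284 ≤ 4e^{−(log 2)/2} = 2√2`. [folklore] -/
theorem gamma_logtwo_even :
    (2.8284 : ℝ) ≤ Real.exp (-(2 * (1 / 4 + ((0 : ℕ) : ℝ) / 2) * Real.log 2)) / (1 / 4 + ((0 : ℕ) : ℝ) / 2) := by
  have hsq : Real.exp (Real.log 2 / 2) = Real.sqrt 2 := by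
    rw [Real.sqrt_eq_rpow, Real.rpow_def_of_pos (by norm_num : (0 : ℝ) < 2)]; ring_nf
  have e : Real.exp (-(2 * (1 / 4 + ((0 : ℕ) : ℝ) / 2) * Real.log 2)) = (Real.sqrt 2)⁻¹ := by
    rw [← hsq, ← Real.exp_neg]; norm_num; ring_nf
  rw [e]
  have hs : (1.41421 : ℝ) < Real.sqrt 2 := Real.lt_sqrt_of_sq_lt (by norm_num)
  have hs' : Real.sqrt 2 < 1.41422 := (Real.sqrt_lt' (by norm_num)).2 (by norm_num)
  have hs0 : 0 < Real.sqrt 2 := by positivity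
  rw [show (Real.sqrt 2)⁻¹ / (1 / 4 + ((0 : ℕ) : ℝ) / 2) = 4 / Real.sqrt 2 by push_cast; field_simp; ring,
    le_div_iff₀ hs0]
  nlinarith

/-- `γ` at `t = log 2`, odd: `0.4714 ≤ (4/3)e^{−(3/2)log 2} = (4/3)/(2√2)`. [folklore] -/
theorem gamma_logtwo_odd :
    (0.4714 : ℝ) ≤ Real.exp (-(2 * (1 / 4 + ((1 : ℕ) : ℝ) / 2) * Real.log 2)) / (1 / 4 + ((1 : ℕ) : ℝ) / 2) := by
  have hsq : Real.exp (Real.log 2 / 2) = Real.sqrt 2 := by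
    rw [Real.sqrt_eq_rpow, Real.rpow_def_of_pos (by norm_num : (0 : ℝ) < 2)]; ring_nf
  have e : Real.exp (-(2 * (1 / 4 + ((1 : ℕ) : ℝ) / 2) * Real.log 2)) = (2 * Real.sqrt 2)⁻¹ := by
    have h1 : -(2 * (1 / 4 + ((1 : ℕ) : ℝ) / 2) * Real.log 2) = -Real.log 2 + -(Real.log 2 / 2) := by
      push_cast; ring
    rw [h1, Real.exp_add, Real.exp_neg, Real.exp_neg, Real.exp_log (by norm_num), hsq, ← mul_inv]
  rw [e]
  have hs : (1.41421 : ℝ) < Real.sqrt 2 := Real.lt_sqrt_of_sq_lt (by norm_num)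
  have hs' : Real.sqrt 2 < 1.41422 := (Real.sqrt_lt' (by norm_num)).2 (by norm_num)
  have hs0 : 0 < Real.sqrt 2 := by positivity
  rw [show (2 * Real.sqrt 2)⁻¹ / (1 / 4 + ((1 : ℕ) : ℝ) / 2) = (2 / 3) / Real.sqrt 2 by push_cast; field_simp; ring,
    le_div_iff₀ hs0]
  nlinarith

/-! ## The floors -/

/-- `log 168 ≥ 5.1146381`, `log 60 ≥ 4.0943445`, `log 54 ≥ 3.988984`, `log 32 ≥ 3.4657359`, `log 15 ≥ 2.7080502`. [folklore] -/
theorem log_floor_bounds_lorentz :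
    (5.1146381 : ℝ) ≤ Real.log 168 ∧ (4.0943445 : ℝ) ≤ Real.log 60 ∧ (3.988984 : ℝ) ≤ Real.log 54 ∧
      (3.4657359 : ℝ) ≤ Real.log 32 ∧ (2.7080502 : ℝ) ≤ Real.log 15 := by
  have h2 := Real.log_two_gt_d9
  have h3 := Real.log_three_gt_d9
  have h5 := Real.log_five_gt_d9
  have h7 := log_seven_ge
  have e168 : Real.log 168 = 3 * Real.log 2 + Real.log 3 + Real.log 7 := by
    rw [show (168 : ℝ) = 2 ^ 3 * 3 * 7 by norm_num, Real.log_mul (by norm_num) (by norm_num),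
      Real.log_mul (by norm_num) (by norm_num), Real.log_pow]
    push_cast; ring
  have e60 : Real.log 60 = 2 * Real.log 2 + Real.log 3 + Real.log 5 := by
    rw [show (60 : ℝ) = 2 ^ 2 * 3 * 5 by norm_num, Real.log_mul (by norm_num) (by norm_num),
      Real.log_mul (by norm_num) (by norm_num), Real.log_pow]
    push_cast; ring
  have e54 : Real.log 54 = Real.log 2 + 3 * Real.log 3 := by
    rw [show (54 : ℝ) = 2 * 3 ^ 3 by norm_num, Real.log_mul (by norm_num) (by norm_num), Real.log_pow]
    push_cast; ring
  have e32 : Real.log 32 = 5 * Real.log 2 := by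
    rw [show (32 : ℝ) = 2 ^ 5 by norm_num, Real.log_pow]; push_cast; ring
  have e15 : Real.log 15 = Real.log 3 + Real.log 5 := by
    rw [show (15 : ℝ) = 3 * 5 by norm_num, Real.log_mul (by norm_num) (by norm_num)]
  refine ⟨?_, ?_, ?_, ?_, ?_⟩
  · rw [e168]; linarith
  · rw [e60]; linarith
  · rw [e54]; linarith
  · rw [e32]; linarith
  · rw [e15]; linarith

/-- **Every EVEN character of modulus `q ≥ 168` satisfies Weil positivity on `[-1, 1]`** (cell certificate
`ρ = 2.1506` + gain `γ = 2.426`; budget `1.1447299 + 4.22745354 − 2.426 + 2.1506 = 5.0967835 ≤ log 168`; method floor `164`).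
[cite: Weil1952FormulesExplicites, (11) and the «lemme» p. 262; Yoshida1992, §6] -/
theorem weilPositivityOnChar_one_of_even_ge_168 (hq : 168 ≤ q) (χ : DirichletCharacter ℂ q) (hχ : χ.Even) :
    WeilPositivityOnChar χ 1 := by
  have hq1 : q ≠ 1 := by omega
  have hlog := log_floor_bounds_lorentz.1.trans (log_le_log_natCast (by norm_num) hq)
  have hπ := Literature.Analysis.SpecialFunctions.Real.log_pi_le
  exact weilPositivityOnChar_of_phi_budget_lorentz hq1 χ (charParity_of_even hχ) one_pos exp_two_le_eight
    psi_even_ge gamma_one_even (by norm_num : 0 < 40) phiOne40 (by norm_num : (0 : ℝ) < 3389 / 10000)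
    one40_philo one40_phihi one40_phiout sOne40 one40_shifts wbar7 (wbar7_ge 7 le_rfl) one40_cert (by linarith)

/-- **Every ODD character of modulus `q ≥ 60` satisfies Weil positivity on `[-1, 1]`** (budget
`1.1447299 + 1.08586154 − 0.2975 + 2.1506 = 4.0836915 ≤ 4.0943445 ≤ log 60`; method floor `60`).
[cite: Weil1952FormulesExplicites, (11) and the «lemme» p. 262; Yoshida1992, §6] -/
theorem weilPositivityOnChar_one_of_odd_ge_60 [NeZero q] (hq : 60 ≤ q) (χ : DirichletCharacter ℂ q) (hχ : χ.Odd) :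
    WeilPositivityOnChar χ 1 := by
  have hq1 : q ≠ 1 := by omega
  have hlog := log_floor_bounds_lorentz.2.1.trans (log_le_log_natCast (by norm_num) hq)
  have hπ := Literature.Analysis.SpecialFunctions.Real.log_pi_le
  exact weilPositivityOnChar_of_phi_budget_lorentz hq1 χ (charParity_of_odd hχ) one_pos exp_two_le_eight
    psi_odd_ge gamma_one_odd (by norm_num : 0 < 40) phiOne40 (by norm_num : (0 : ℝ) < 3389 / 10000)
    one40_philo one40_phihi one40_phiout sOne40 one40_shifts wbar7 (wbar7_ge 7 le_rfl) one40_cert (by linarith)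

/-- **UNIFORM FLOOR AT `t = 1`: every Dirichlet character (any parity, any values, primitive or not) of every modulus
`q ≥ 168` satisfies `WeilPositivityOnChar χ 1`** — Weil positivity on `[-1, 1]`; no `ζ` input, no kernel certificate.
[cite: Weil1952FormulesExplicites, (11) and the «lemme» p. 262; Yoshida1992, §6] -/
theorem weilPositivityOnChar_one_of_ge_168 (hq : 168 ≤ q) (χ : DirichletCharacter ℂ q) :
    WeilPositivityOnChar χ 1 := by
  haveI : NeZero q := ⟨by omega⟩
  rcases χ.even_or_odd with h | h
  · exact weilPositivityOnChar_one_of_even_ge_168 hq χ h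
  · exact weilPositivityOnChar_one_of_odd_ge_60 (by omega) χ h

/-- … hence every rung `t ≤ 1` for every character of modulus `q ≥ 168`. [folklore] -/
theorem weilPositivityOnChar_of_le_one_of_ge_168 (hq : 168 ≤ q) (χ : DirichletCharacter ℂ q) {t : ℝ}
    (ht : t ≤ 1) : WeilPositivityOnChar χ t :=
  (weilPositivityOnChar_one_of_ge_168 hq χ).mono ht

/-- **Every EVEN character of modulus `q ≥ 54` satisfies `WeilPositivityOnChar χ (4023/5000)`** (`ρ = 1.2555`, `γ = 2.675`;
budget `3.9526835 ≤ 3.988984 ≤ log 54`; method floor `53`). [cite: Weil1952FormulesExplicites, (11) and the «lemme» p. 262; Yoshida1992, §6] -/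
theorem weilPositivityOnChar_frontier_of_even_ge_54 (hq : 54 ≤ q) (χ : DirichletCharacter ℂ q) (hχ : χ.Even) :
    WeilPositivityOnChar χ (4023 / 5000) := by
  have hq1 : q ≠ 1 := by omega
  have hlog := log_floor_bounds_lorentz.2.2.1.trans (log_le_log_natCast (by norm_num) hq)
  have hπ := Literature.Analysis.SpecialFunctions.Real.log_pi_le
  exact weilPositivityOnChar_of_phi_budget_lorentz hq1 χ (charParity_of_even hχ) (by norm_num) exp_frontier_le_five
    psi_even_ge gamma_frontier_even (by norm_num : 0 < 20) phiFr20 (by norm_num : (0 : ℝ) < 3237 / 10000)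
    frontier20_philo frontier20_phihi frontier20_phiout sFr20 frontier20_shifts wbar7 (wbar7_ge 4 (by norm_num))
    frontier20_cert (by linarith)

/-- **Every ODD character of modulus `q ≥ 24` satisfies `WeilPositivityOnChar χ (4023/5000)`** (`γ = 0.3987`; budget
`3.0873915 ≤ 3.1780538 ≤ log 24`; method floor `22`). [cite: Weil1952FormulesExplicites, (11) and the «lemme» p. 262; Yoshida1992, §6] -/
theorem weilPositivityOnChar_frontier_of_odd_ge_24 [NeZero q] (hq : 24 ≤ q) (χ : DirichletCharacter ℂ q)
    (hχ : χ.Odd) : WeilPositivityOnChar χ (4023 / 5000) := by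
  have hq1 : q ≠ 1 := by omega
  have hlog := log_40_24_ge.2.trans (log_le_log_natCast (by norm_num) hq)
  have hπ := Literature.Analysis.SpecialFunctions.Real.log_pi_le
  exact weilPositivityOnChar_of_phi_budget_lorentz hq1 χ (charParity_of_odd hχ) (by norm_num) exp_frontier_le_five
    psi_odd_ge gamma_frontier_odd (by norm_num : 0 < 20) phiFr20 (by norm_num : (0 : ℝ) < 3237 / 10000)
    frontier20_philo frontier20_phihi frontier20_phiout sFr20 frontier20_shifts wbar7 (wbar7_ge 4 (by norm_num))
    frontier20_cert (by linarith)

/-- **UNIFORM FLOOR AT THE `ζ` FRONTIER: every Dirichlet character of every modulus `q ≥ 54` satisfies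
`WeilPositivityOnChar χ (4023/5000)`** (sharp data floor `30`). [cite: Weil1952FormulesExplicites, (11) and the «lemme» p. 262; Yoshida1992, §6] -/
theorem weilPositivityOnChar_frontier_of_ge_54 (hq : 54 ≤ q) (χ : DirichletCharacter ℂ q) :
    WeilPositivityOnChar χ (4023 / 5000) := by
  haveI : NeZero q := ⟨by omega⟩
  rcases χ.even_or_odd with h | h
  · exact weilPositivityOnChar_frontier_of_even_ge_54 hq χ h
  · exact weilPositivityOnChar_frontier_of_odd_ge_24 (by omega) χ h

/-- **Every EVEN character of modulus `q ≥ 32` satisfies `WeilPositivityOnChar χ (log 2)`** (`ρ = 0.901`, `γ = 2.8284`;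
budget `≤ 3.4447835 ≤ 3.4657359 ≤ log 32`). [cite: Weil1952FormulesExplicites, (11) and the «lemme» p. 262; Yoshida1992, §6] -/
theorem weilPositivityOnChar_log_two_of_even_ge_32 (hq : 32 ≤ q) (χ : DirichletCharacter ℂ q) (hχ : χ.Even) :
    WeilPositivityOnChar χ (Real.log 2) := by
  have hq1 : q ≠ 1 := by omega
  have hlog := log_floor_bounds_lorentz.2.2.2.1.trans (log_le_log_natCast (by norm_num) hq)
  have hπ := Literature.Analysis.SpecialFunctions.Real.log_pi_le
  exact weilPositivityOnChar_of_phi_budget_lorentz hq1 χ (charParity_of_even hχ) (Real.log_pos (by norm_num))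
    exp_two_log_two_le_four psi_even_ge gamma_logtwo_even (by norm_num : 0 < 40) phiLt40
    (by norm_num : (0 : ℝ) < 37 / 125) logtwo40_philo logtwo40_phihi logtwo40_phiout sLt40 logtwo40_shifts wbar7
    (wbar7_ge 3 (by norm_num)) logtwo40_cert (by linarith)

/-- **Every ODD character of modulus `q ≥ 15` satisfies `WeilPositivityOnChar χ (log 2)`** (`γ = 0.4714`; budget
`2.6601915 ≤ 2.7080502 ≤ log 15`). [cite: Weil1952FormulesExplicites, (11) and the «lemme» p. 262; Yoshida1992, §6] -/
theorem weilPositivityOnChar_log_two_of_odd_ge_15 [NeZero q] (hq : 15 ≤ q) (χ : DirichletCharacter ℂ q)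
    (hχ : χ.Odd) : WeilPositivityOnChar χ (Real.log 2) := by
  have hq1 : q ≠ 1 := by omega
  have hlog := log_floor_bounds_lorentz.2.2.2.2.trans (log_le_log_natCast (by norm_num) hq)
  have hπ := Literature.Analysis.SpecialFunctions.Real.log_pi_le
  exact weilPositivityOnChar_of_phi_budget_lorentz hq1 χ (charParity_of_odd hχ) (Real.log_pos (by norm_num))
    exp_two_log_two_le_four psi_odd_ge gamma_logtwo_odd (by norm_num : 0 < 40) phiLt40
    (by norm_num : (0 : ℝ) < 37 / 125) logtwo40_philo logtwo40_phihi logtwo40_phiout sLt40 logtwo40_shifts wbar7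
    (wbar7_ge 3 (by norm_num)) logtwo40_cert (by linarith)

/-- **UNIFORM FLOOR AT `log 2`: every Dirichlet character of every modulus `q ≥ 32` satisfies `WeilPositivityOnChar χ (log 2)`**
(the tree's `ζ`-transfer floor was `50`; sharp data floor `18`). [cite: Weil1952FormulesExplicites, (11) and the «lemme» p. 262; Yoshida1992, §6] -/
theorem weilPositivityOnChar_log_two_of_ge_32 (hq : 32 ≤ q) (χ : DirichletCharacter ℂ q) :
    WeilPositivityOnChar χ (Real.log 2) := by
  haveI : NeZero q := ⟨by omega⟩
  rcases χ.even_or_odd with h | h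
  · exact weilPositivityOnChar_log_two_of_even_ge_32 hq χ h
  · exact weilPositivityOnChar_log_two_of_odd_ge_15 (by omega) χ h

end UniformFloor

end Summit.Ventures.WeilGRH

end
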